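import Literature.NumberTheory.Automorphic.HeckeTraceFormulaGL2Level
import Mathlib.NumberTheory.DirichletCharacter.Bounds
import Mathlib.Analysis.SpecialFunctions.Pow.Real
import HarnessLib

/-!
# Murty–Sinha's multiplicity bound: estimates for the geometric side of the trace formula
# (weight `2`, trivial character)

Sibling file of `Literature.NumberTheory.EllipticCurves.MurtySinhaMultiplicity` (named fact
`murtySinha2009_eigenvalue_multiplicity_weightTwo`, M. R. Murty, K. Sinha, J. Number Theory
**129** (2009) 681–714 [MurtySinha2009]). It bounds the four terms `A₁, A₂, A₃, A₄` of the
Eichler–Selberg trace formula in the Cohen–Oesterlé / Schoof–van der Vlugt form vendored in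
`Literature.NumberTheory.Automorphic.HeckeTraceFormulaGL2Level` (`identityTerm`, `ellipticTerm`,
`hyperbolicTerm`, `parabolicTerm`), for weight `k = 2` and the trivial character, in the crude
shape used by Murty–Sinha §§7–9 (Thm. 10, Lemma 12, Thm. 13, (8), (11)–(14), Thm. 18):

* `A₁(p^m) = [m even] ψ(N)/12` for `p ∤ N` (loc. cit. (4), (9));
* `|A₂(n)| ≤ C n^6 · B(N)`, `|A₃(n)| ≤ n² · B(N)`, `|A₄(n)| ≤ n²`, where
  `B(N) = Σ_{c ∣ N} gcd(c, N/c) ≤ d(N) √N ≤ 81 N^{5/6}`.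

Murty–Sinha bound `A₂` through Hurwitz's class number formula (Lemma 16) and Huxley's bound
`M(t, n, K) ≤ 2^{ν(K)} √|t² - 4n|` for the number of roots of `x² - tx + n (mod K)` (Lemma 12),
and `A₃` through `f(N) = Σ_{c ∣ N} φ(gcd(c, N/c)) ≤ √N d(N)` (p. 696). For the qualitative
statement of eq. (1) (an unspecified absolute constant) any bound polynomial in `n` and of size
`N^{1-δ}` in `N` suffices, and we prove such bounds by elementary counting:

* `MurtySinha.card_filter_dvd_quadratic_le` — **the number of `x (mod N)` with
  `x² - tx + n ≡ 0 (mod N)` is at most `B(N) = Σ_{d ∣ N} gcd(d, N/d)`** (two roots differ by `a`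
  with `N ∣ a(a + s)`; for `gcd(a, N) = d` this forces `a ≡ 0 (d)`, `a ≡ -s (N/d)`, a single class
  modulo `lcm(d, N/d) = N/gcd(d, N/d)`) — replacing Huxley's Lemma 12;
* `MurtySinha.classNumber_le` — `h(Δ) ≤ (|Δ|+1)(2|Δ|+1)` (the reduced forms are among the
  `(redBound + 1)(2 redBound + 1)` candidates of `BinQF.reducedFormsList`) — replacing Lemma 16;
* `MurtySinha.card_divisors_le_rpow` — `d(N) ≤ 81 N^{1/3}` (Murty–Sinha Lemma 28 with `ε = 1/3`:
  `(e+1)³ ≤ p^e` for `p ≥ 8`, `≤ 27 · 2^e` always);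
* `MurtySinha.dedekindPsi_le_sq_mul_dedekindPsi_div` — `ψ(N) ≤ g² ψ(N/g)` for `g ∣ N`, bounding
  the level factor `ψ(N)/ψ(N/N_f)` of the local densities `μ(t, f, n)` (loc. cit. p. 699, (12)).

No new definitions or named facts are introduced; `B(N)` is always written out.

## References

* [MurtySinha2009] §7 Thm. 10, Lemma 12, Thm. 13; §8 (8), Thm. 18; §9 (11)–(14); §14 Lemma 28.
* [SchoofVandervlugt1991] Thm. 2.2 (the terms `A₁`–`A₄` as vendored).
-/

noncomputable section

open scoped ComplexConjugate

namespace Literature.NumberTheory.EllipticCurves.ModularForms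

namespace MurtySinha

open Finset
open Literature.NumberTheory.Automorphic
open Literature.NumberTheory.Automorphic.HeckeTraceFormulaGL2Level
open Literature.NumberTheory.QuadraticFields.Quadratic

/-! ### Class numbers: `h(Δ) ≤ (|Δ|+1)(2|Δ|+1)` -/

/-- `bndAux n k ≤ k` (the search never exceeds its fuel). [folklore] -/
theorem bndAux_le (n k : ℕ) : BinQF.bndAux n k ≤ k := by
  induction k with
  | zero => simp [BinQF.bndAux]
  | succ k ih =>
    simp only [BinQF.bndAux]
    split_ifs
    · exact le_rfl
    · exact ih.trans (Nat.le_succ k)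

/-- `redBound D ≤ |D|`. [folklore] -/
theorem redBound_le (D : ℤ) : BinQF.redBound D ≤ D.natAbs :=
  bndAux_le _ _

/-- **Crude class number bound** `h(Δ) ≤ (|Δ|+1)(2|Δ|+1)`: the reduced forms of discriminant `Δ`
are among the `(redBound Δ + 1)(2 redBound Δ + 1)` candidates `(a, b, ·)` with
`0 ≤ a ≤ redBound Δ ≤ |Δ|`, `|b| ≤ redBound Δ` (Cox (2.8); Murty–Sinha use instead Hurwitz's exact
formula, Lemma 16). [folklore] -/
theorem classNumber_le (D : ℤ) : BinQF.classNumber D ≤ (D.natAbs + 1) * (2 * D.natAbs + 1) := by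
  unfold BinQF.classNumber BinQF.reducedFormsList
  refine (List.length_filter_le _ _).trans ?_
  have hlen : (BinQF.candidatesList D).length =
      (BinQF.redBound D + 1) * (2 * BinQF.redBound D + 1) := by
    simp [BinQF.candidatesList, List.length_flatMap, List.map_const', List.sum_replicate]
  rw [hlen]
  have h := redBound_le D
  exact Nat.mul_le_mul (by omega) (by omega)

/-- `0 ≤ h_w(Δ)`. [folklore] -/
theorem weightedClassNumber_nonneg (Δ : ℤ) : 0 ≤ weightedClassNumber Δ := by
  unfold weightedClassNumber
  split_ifs <;> positivity

/-- `h_w(Δ) ≤ h(Δ) + 1`. [folklore] -/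
theorem weightedClassNumber_le (Δ : ℤ) : weightedClassNumber Δ ≤ BinQF.classNumber Δ + 1 := by
  unfold weightedClassNumber
  have h0 : (0 : ℚ) ≤ BinQF.classNumber Δ := by positivity
  split_ifs
  · linarith
  · linarith
  · linarith

/-! ### Divisors: `d(N) ≤ 81 N^{1/3}`, `gcd(c, N/c) ≤ √N` -/

/-- `(e+1)³ ≤ 27 · 2^e` for all `e`. [folklore] -/
theorem succ_pow_three_le_mul_two_pow (e : ℕ) : (e + 1) ^ 3 ≤ 27 * 2 ^ e := by
  induction e with
  | zero => norm_num
  | succ e ih =>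
    rcases lt_or_ge e 3 with he | he
    · interval_cases e <;> norm_num
    · have hcube : 6 * e + 6 ≤ e ^ 3 := by
        have h1 : 3 * e ≤ e * e := Nat.mul_le_mul_right e he
        have h2 : 3 * (e * e) ≤ e * (e * e) := Nat.mul_le_mul_right (e * e) he
        have h3 : e ^ 3 = e * (e * e) := by ring
        rw [h3]
        omega
      have hstep : (e + 2) ^ 3 ≤ 2 * (e + 1) ^ 3 := by
        have hl : (e + 2) ^ 3 = e ^ 3 + 6 * e ^ 2 + 12 * e + 8 := by ring
        have hr : 2 * (e + 1) ^ 3 = 2 * e ^ 3 + 6 * e ^ 2 + 6 * e + 2 := by ring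
        rw [hl, hr]
        omega
      calc (e + 1 + 1) ^ 3 = (e + 2) ^ 3 := by ring
        _ ≤ 2 * (e + 1) ^ 3 := hstep
        _ ≤ 2 * (27 * 2 ^ e) := Nat.mul_le_mul_left 2 ih
        _ = 27 * 2 ^ (e + 1) := by ring

/-- `(e+1)³ ≤ 8^e`. [folklore] -/
theorem succ_pow_three_le_eight_pow (e : ℕ) : (e + 1) ^ 3 ≤ 8 ^ e := by
  have h : e + 1 ≤ 2 ^ e := Nat.lt_two_pow_self
  calc (e + 1) ^ 3 ≤ (2 ^ e) ^ 3 := Nat.pow_le_pow_left h 3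
    _ = 8 ^ e := by rw [← pow_mul, mul_comm, pow_mul]; norm_num

/-- **Divisor bound, cubed:** `d(N)³ ≤ 3¹² · N` (Murty–Sinha Lemma 28 with `ε = 1/3`: writing
`d(N) = ∏ (e_p + 1)`, one has `(e_p+1)³ ≤ p^{e_p}` for `p ≥ 8` and `(e_p+1)³ ≤ 27 p^{e_p}` for the
four primes `p < 8`). [cite: MurtySinha2009, Lemma 28 p. 704] -/
theorem card_divisors_pow_three_le (N : ℕ) : N.divisors.card ^ 3 ≤ 3 ^ 12 * N := by
  rcases Nat.eq_zero_or_pos N with rfl | hN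
  · simp
  have hN0 : N ≠ 0 := hN.ne'
  classical
  have hcard : N.divisors.card = ∏ p ∈ N.primeFactors, (N.factorization p + 1) :=
    Nat.card_divisors hN0
  have hNprod : ∏ p ∈ N.primeFactors, p ^ N.factorization p = N := by
    conv_rhs => rw [← Nat.prod_factorization_pow_eq_self hN0]
    rw [Finsupp.prod, Nat.support_factorization]
  -- termwise bound with the constant `c_p = 27` for `p < 8`, `1` otherwise
  have hterm : ∀ p ∈ N.primeFactors, (N.factorization p + 1) ^ 3 ≤
      (if p < 8 then 27 else 1) * p ^ N.factorization p := by
    intro p hp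
    have hp2 : 2 ≤ p := (Nat.prime_of_mem_primeFactors hp).two_le
    split_ifs with h8
    · calc (N.factorization p + 1) ^ 3 ≤ 27 * 2 ^ N.factorization p :=
            succ_pow_three_le_mul_two_pow _
        _ ≤ 27 * p ^ N.factorization p :=
            Nat.mul_le_mul_left 27 (Nat.pow_le_pow_left hp2 _)
    · have h8 : 8 ≤ p := not_lt.mp h8
      calc (N.factorization p + 1) ^ 3 ≤ 8 ^ N.factorization p := succ_pow_three_le_eight_pow _
        _ ≤ p ^ N.factorization p := Nat.pow_le_pow_left h8 _
        _ = 1 * p ^ N.factorization p := (one_mul _).symm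
  have hconst : ∏ p ∈ N.primeFactors, (if p < 8 then 27 else 1) ≤ 3 ^ 12 := by
    rw [Finset.prod_ite, Finset.prod_const_one, mul_one, Finset.prod_const]
    have hsub : N.primeFactors.filter (· < 8) ⊆ (Finset.range 8).filter Nat.Prime := by
      intro p hp
      rw [Finset.mem_filter] at hp ⊢
      exact ⟨Finset.mem_range.mpr hp.2, Nat.prime_of_mem_primeFactors hp.1⟩
    have hcard4 : ((Finset.range 8).filter Nat.Prime).card = 4 := by decide
    calc 27 ^ (N.primeFactors.filter (· < 8)).card
        ≤ 27 ^ ((Finset.range 8).filter Nat.Prime).card :=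
          Nat.pow_le_pow_right (by norm_num) (Finset.card_le_card hsub)
      _ = 3 ^ 12 := by rw [hcard4]; norm_num
  calc N.divisors.card ^ 3 = ∏ p ∈ N.primeFactors, (N.factorization p + 1) ^ 3 := by
        rw [hcard, Finset.prod_pow]
    _ ≤ ∏ p ∈ N.primeFactors, ((if p < 8 then 27 else 1) * p ^ N.factorization p) :=
        Finset.prod_le_prod (fun _ _ ↦ Nat.zero_le _) hterm
    _ = (∏ p ∈ N.primeFactors, (if p < 8 then 27 else 1)) * N := by
        rw [Finset.prod_mul_distrib, hNprod]
    _ ≤ 3 ^ 12 * N := Nat.mul_le_mul_right N hconst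

/-- **Divisor bound** `d(N) ≤ 81 N^{1/3}` (Murty–Sinha Lemma 28 with `ε = 1/3`).
[cite: MurtySinha2009, Lemma 28 p. 704] -/
theorem card_divisors_le_rpow (N : ℕ) :
    (N.divisors.card : ℝ) ≤ 81 * (N : ℝ) ^ ((1 : ℝ) / 3) := by
  have h := card_divisors_pow_three_le N
  have h' : ((N.divisors.card : ℝ)) ^ (3 : ℕ) ≤ (81 : ℝ) ^ (3 : ℕ) * N := by
    have : ((N.divisors.card ^ 3 : ℕ) : ℝ) ≤ ((3 ^ 12 * N : ℕ) : ℝ) := by exact_mod_cast h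
    push_cast at this
    linarith
  have hd0 : (0 : ℝ) ≤ N.divisors.card := by positivity
  have hN0 : (0 : ℝ) ≤ N := by positivity
  calc (N.divisors.card : ℝ) = (((N.divisors.card : ℝ)) ^ (3 : ℕ)) ^ ((3 : ℕ) : ℝ)⁻¹ :=
        (Real.pow_rpow_inv_natCast hd0 (by norm_num)).symm
    _ ≤ ((81 : ℝ) ^ (3 : ℕ) * N) ^ ((3 : ℕ) : ℝ)⁻¹ :=
        Real.rpow_le_rpow (by positivity) h' (by positivity)
    _ = 81 * (N : ℝ) ^ ((1 : ℝ) / 3) := by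
        rw [Real.mul_rpow (by positivity) hN0, Real.pow_rpow_inv_natCast (by norm_num) (by norm_num)]
        norm_num

/-- `gcd(c, N/c) ≤ √N` for `c ∣ N`: the square of `g = gcd(c, N/c)` divides `c · (N/c) = N`.
[folklore] -/
theorem gcd_div_le_sqrt {N c : ℕ} (hN : N ≠ 0) (hc : c ∣ N) :
    (Nat.gcd c (N / c) : ℝ) ≤ Real.sqrt N := by
  have hmul : c * (N / c) = N := Nat.mul_div_cancel' hc
  have hg2 : Nat.gcd c (N / c) * Nat.gcd c (N / c) ∣ N := by
    have h : Nat.gcd c (N / c) * Nat.gcd c (N / c) ∣ c * (N / c) :=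
      Nat.mul_dvd_mul (Nat.gcd_dvd_left _ _) (Nat.gcd_dvd_right _ _)
    rwa [hmul] at h
  have hle : Nat.gcd c (N / c) * Nat.gcd c (N / c) ≤ N := Nat.le_of_dvd (Nat.pos_of_ne_zero hN) hg2
  refine Real.le_sqrt_of_sq_le ?_
  rw [sq]
  exact_mod_cast hle

/-- `B(N) = Σ_{c ∣ N} gcd(c, N/c) ≤ d(N) √N` (cf. Murty–Sinha p. 696: `f(N) ≤ √N d(N)`).
[cite: MurtySinha2009, §8 p. 696 (bound for f(N))] -/
theorem sum_divisors_gcd_le (N : ℕ) (hN : N ≠ 0) :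
    ∑ c ∈ N.divisors, (Nat.gcd c (N / c) : ℝ) ≤ N.divisors.card * Real.sqrt N := by
  calc ∑ c ∈ N.divisors, (Nat.gcd c (N / c) : ℝ) ≤ ∑ c ∈ N.divisors, Real.sqrt N :=
        Finset.sum_le_sum fun c hc ↦ gcd_div_le_sqrt hN (Nat.dvd_of_mem_divisors hc)
    _ = N.divisors.card * Real.sqrt N := by rw [Finset.sum_const, nsmul_eq_mul]

/-- `B(N) ≤ 81 N^{5/6}`. [folklore] -/
theorem sum_divisors_gcd_le_rpow (N : ℕ) (hN : N ≠ 0) :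
    ∑ c ∈ N.divisors, (Nat.gcd c (N / c) : ℝ) ≤ 81 * (N : ℝ) ^ ((5 : ℝ) / 6) := by
  have hN0 : (0 : ℝ) ≤ N := by positivity
  calc ∑ c ∈ N.divisors, (Nat.gcd c (N / c) : ℝ) ≤ N.divisors.card * Real.sqrt N :=
        sum_divisors_gcd_le N hN
    _ ≤ (81 * (N : ℝ) ^ ((1 : ℝ) / 3)) * Real.sqrt N :=
        mul_le_mul_of_nonneg_right (card_divisors_le_rpow N) (Real.sqrt_nonneg _)
    _ = 81 * (N : ℝ) ^ ((5 : ℝ) / 6) := by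
        rw [Real.sqrt_eq_rpow, mul_assoc, ← Real.rpow_add' hN0 (by norm_num)]
        norm_num

/-! ### Roots of `x² - tx + n` modulo `N` -/

/-- For fixed `s`, the number of `a (mod N)` with `N ∣ a(a+s)` is at most
`B(N) = Σ_{d ∣ N} gcd(d, N/d)`: if `gcd(a, N) = d` then `a ≡ 0 (mod d)` and `a ≡ -s (mod N/d)`,
which pins `a` down modulo `lcm(d, N/d) = N / gcd(d, N/d)`. [folklore] -/
theorem card_filter_dvd_mul_add_le (N : ℕ) (hN : N ≠ 0) (s : ℤ) :
    ((Finset.range N).filter fun a : ℕ ↦ (N : ℤ) ∣ (a : ℤ) * (a + s)).card ≤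
      ∑ d ∈ N.divisors, Nat.gcd d (N / d) := by
  classical
  set A := (Finset.range N).filter fun a : ℕ ↦ (N : ℤ) ∣ (a : ℤ) * (a + s) with hA
  have hmap : ∀ a ∈ A, Nat.gcd a N ∈ N.divisors := fun a _ ↦
    Nat.mem_divisors.2 ⟨Nat.gcd_dvd_right _ _, hN⟩
  rw [Finset.card_eq_sum_card_fiberwise hmap]
  refine Finset.sum_le_sum fun d hd ↦ ?_
  have hdN : d ∣ N := Nat.dvd_of_mem_divisors hd
  have hd0 : d ≠ 0 := fun h ↦ hN (by simpa [h] using hdN)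
  set M := N / d with hM
  have hNdM : N = d * M := (Nat.mul_div_cancel' hdN).symm
  have hM0 : M ≠ 0 := fun h ↦ hN (by simp [hNdM, h])
  set g := Nat.gcd d M with hg
  set L := Nat.lcm d M with hL
  have hgL : g * L = N := by rw [hg, hL, Nat.gcd_mul_lcm, hNdM]
  have hL0 : 0 < L := Nat.pos_of_ne_zero (Nat.lcm_ne_zero hd0 hM0)
  -- every element of the fibre is `≡ 0 (d)` and `≡ -s (M)`
  have hfib : ∀ a ∈ A.filter (fun a ↦ Nat.gcd a N = d),
      (d : ℤ) ∣ (a : ℤ) ∧ (M : ℤ) ∣ (a : ℤ) + s := by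
    intro a ha
    rw [Finset.mem_filter] at ha
    obtain ⟨haA, hda⟩ := ha
    have hdiv : (N : ℤ) ∣ (a : ℤ) * (a + s) := (Finset.mem_filter.mp haA).2
    have hda' : d ∣ a := hda ▸ Nat.gcd_dvd_left a N
    refine ⟨Int.natCast_dvd_natCast.mpr hda', ?_⟩
    obtain ⟨a', rfl⟩ := hda'
    have hcop : Nat.Coprime a' M := by
      have hpos : 0 < Nat.gcd (d * a') N := Nat.pos_of_ne_zero (by rw [hda]; exact hd0)
      have h := Nat.coprime_div_gcd_div_gcd hpos
      rw [hda, Nat.mul_div_cancel_left _ (Nat.pos_of_ne_zero hd0)] at h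
      exact h
    have h1 : (d : ℤ) * M ∣ (d : ℤ) * ((a' : ℤ) * ((d * a' : ℕ) + s)) := by
      have : ((N : ℕ) : ℤ) = (d : ℤ) * M := by rw [hNdM]; push_cast; ring
      rw [← this]
      have e : ((d * a' : ℕ) : ℤ) * ((d * a' : ℕ) + s) = (d : ℤ) * ((a' : ℤ) * ((d * a' : ℕ) + s)) := by
        push_cast; ring
      rw [← e]
      exact hdiv
    have h2 : (M : ℤ) ∣ (a' : ℤ) * ((d * a' : ℕ) + s) :=
      (mul_dvd_mul_iff_left (by exact_mod_cast hd0 : (d : ℤ) ≠ 0)).mp h1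
    have hcopZ : IsCoprime (M : ℤ) (a' : ℤ) := Nat.isCoprime_iff_coprime.mpr hcop.symm
    exact hcopZ.dvd_of_dvd_mul_left h2
  -- hence two elements of the fibre are congruent modulo `L = lcm(d, M)`
  have hcong : ∀ a ∈ A.filter (fun a ↦ Nat.gcd a N = d), ∀ b ∈ A.filter (fun a ↦ Nat.gcd a N = d),
      a % L = b % L := by
    intro a ha b hb
    obtain ⟨ha1, ha2⟩ := hfib a ha
    obtain ⟨hb1, hb2⟩ := hfib b hb
    have hdvd_d : (d : ℤ) ∣ (b : ℤ) - a := dvd_sub hb1 ha1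
    have hdvd_M : (M : ℤ) ∣ (b : ℤ) - a := by
      have := dvd_sub hb2 ha2
      simpa using this
    have hdvd_L : (L : ℤ) ∣ (b : ℤ) - a := by
      rw [Int.natCast_dvd] at hdvd_d hdvd_M ⊢
      exact hL ▸ Nat.lcm_dvd hdvd_d hdvd_M
    exact (Nat.modEq_iff_dvd.mpr hdvd_L)
  -- so `a ↦ a / L` is injective on the fibre, with values in `range g`
  calc (A.filter fun a ↦ Nat.gcd a N = d).card ≤ (Finset.range g).card := by
        refine Finset.card_le_card_of_injOn (fun a ↦ a / L) (fun a ha ↦ ?_) ?_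
        · rw [Finset.coe_range, Set.mem_Iio, Nat.div_lt_iff_lt_mul hL0, hgL]
          exact Finset.mem_range.mp (Finset.mem_filter.mp (Finset.mem_filter.mp ha).1).1
        · intro a ha b hb hab
          have h := hcong a ha b hb
          calc a = L * (a / L) + a % L := (Nat.div_add_mod a L).symm
            _ = L * (b / L) + b % L := by rw [show a / L = b / L from hab, h]
            _ = b := Nat.div_add_mod b L
    _ = g := Finset.card_range g
    _ = Nat.gcd d (N / d) := rfl

/-- **The number of `x (mod N)` with `x² - tx + n ≡ 0 (mod N)` is at most
`B(N) = Σ_{d ∣ N} gcd(d, N/d)`** (elementary substitute for Huxley's bound, Murty–Sinha Lemma 12: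
two roots `x, x₀` satisfy `N ∣ (x - x₀)(x + x₀ - t)`). [cite: MurtySinha2009, Lemma 12 p. 693 (the quantity M(a, b, K))] -/
theorem card_filter_dvd_quadratic_le (N : ℕ) (hN : N ≠ 0) (t n : ℤ) :
    ((Finset.range N).filter fun x : ℕ ↦ (N : ℤ) ∣ (x : ℤ) ^ 2 - t * x + n).card ≤
      ∑ d ∈ N.divisors, Nat.gcd d (N / d) := by
  classical
  set S := (Finset.range N).filter fun x : ℕ ↦ (N : ℤ) ∣ (x : ℤ) ^ 2 - t * x + n with hS
  rcases S.eq_empty_or_nonempty with hS0 | ⟨x₀, hx₀⟩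
  · rw [hS0, Finset.card_empty]
    exact Nat.zero_le _
  have hx₀N : x₀ < N := Finset.mem_range.mp (Finset.mem_filter.mp hx₀).1
  have hx₀d : (N : ℤ) ∣ (x₀ : ℤ) ^ 2 - t * x₀ + n := (Finset.mem_filter.mp hx₀).2
  set s : ℤ := 2 * x₀ - t with hs
  refine le_trans ?_ (card_filter_dvd_mul_add_le N hN s)
  refine Finset.card_le_card_of_injOn (fun x ↦ (x + (N - x₀)) % N) (fun x hx ↦ ?_) ?_
  · have hxd : (N : ℤ) ∣ (x : ℤ) ^ 2 - t * x + n := (Finset.mem_filter.mp hx).2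
    rw [Finset.coe_filter, Set.mem_setOf_eq]
    refine ⟨Finset.mem_range.mpr (Nat.mod_lt _ (Nat.pos_of_ne_zero hN)), ?_⟩
    -- work in `ZMod N`
    rw [← ZMod.intCast_zmod_eq_zero_iff_dvd] at hxd hx₀d ⊢
    push_cast at hxd hx₀d ⊢
    rw [Nat.cast_sub hx₀N.le, ZMod.natCast_self, zero_sub, hs]
    push_cast
    linear_combination hxd - hx₀d
  · intro x hx y hy hxy
    have hxN : x < N := Finset.mem_range.mp (Finset.mem_filter.mp hx).1
    have hyN : y < N := Finset.mem_range.mp (Finset.mem_filter.mp hy).1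
    have h : x % N = y % N := by
      have := Nat.ModEq.add_right_cancel' (N - x₀) (hxy : (x + (N - x₀)) % N = (y + (N - x₀)) % N)
      exact this
    rwa [Nat.mod_eq_of_lt hxN, Nat.mod_eq_of_lt hyN] at h

/-! ### The Dedekind `ψ` function -/

/-- `ψ(N) ≥ N`. [folklore] -/
theorem le_dedekindPsi (N : ℕ) : (N : ℚ) ≤ dedekindPsi N := by
  unfold dedekindPsi
  have h1 : (1 : ℚ) ≤ ∏ p ∈ N.primeFactors, (1 + (p : ℚ)⁻¹) :=
    Finset.prod_induction _ (fun x : ℚ ↦ 1 ≤ x) (fun a b ha hb ↦ one_le_mul_of_one_le_of_one_le ha hb)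
      le_rfl (fun p _ ↦ le_add_of_nonneg_right (by positivity))
  calc (N : ℚ) = N * 1 := (mul_one _).symm
    _ ≤ N * ∏ p ∈ N.primeFactors, (1 + (p : ℚ)⁻¹) := mul_le_mul_of_nonneg_left h1 (by positivity)

/-- `0 ≤ ψ(N)`. [folklore] -/
theorem dedekindPsi_nonneg (N : ℕ) : 0 ≤ dedekindPsi N :=
  le_trans (by positivity) (le_dedekindPsi N)

/-- **Level factor of the local densities:** `ψ(N) ≤ g² ψ(N/g)` for `g ∣ N`, `N ≠ 0`; hence
`ψ(N)/ψ(N/N_f) ≤ N_f² ≤ f²` in `μ(t, f, n)` (Murty–Sinha p. 699: `μ(t,f,n) ≤ ψ(N_f) M(t,n,NN_f)`,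
`ψ(N_f) ≤ 2^{ν(N)} N_f`; here the cruder `2^{ν(g)} ≤ g`). [cite: MurtySinha2009, §9 p. 699 (bound for μ(t, f, n))] -/
theorem dedekindPsi_le_sq_mul_dedekindPsi_div {N g : ℕ} (hN : N ≠ 0) (hg : g ∣ N) :
    dedekindPsi N ≤ (g : ℚ) ^ 2 * dedekindPsi (N / g) := by
  classical
  have hg0 : g ≠ 0 := fun h ↦ hN (by simpa [h] using hg)
  set M := N / g with hM
  have hNgM : N = g * M := (Nat.mul_div_cancel' hg).symm
  have hM0 : M ≠ 0 := fun h ↦ hN (by simp [hNgM, h])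
  have hsub : M.primeFactors ⊆ N.primeFactors :=
    Nat.primeFactors_mono ⟨g, by rw [hNgM, mul_comm]⟩ hN
  have hdiff : N.primeFactors \ M.primeFactors ⊆ g.primeFactors := by
    intro p hp
    rw [Finset.mem_sdiff] at hp
    have hpp : p.Prime := Nat.prime_of_mem_primeFactors hp.1
    have hpN : p ∣ N := Nat.dvd_of_mem_primeFactors hp.1
    rw [hNgM] at hpN
    rcases hpp.dvd_mul.mp hpN with h | h
    · exact Nat.mem_primeFactors.mpr ⟨hpp, h, hg0⟩
    · exact absurd (Nat.mem_primeFactors.mpr ⟨hpp, h, hM0⟩) hp.2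
  -- split the product over `N.primeFactors`
  have hsplit : ∏ p ∈ N.primeFactors, (1 + (p : ℚ)⁻¹) =
      (∏ p ∈ N.primeFactors \ M.primeFactors, (1 + (p : ℚ)⁻¹)) *
        ∏ p ∈ M.primeFactors, (1 + (p : ℚ)⁻¹) := (Finset.prod_sdiff hsub).symm
  -- the extra factor is at most `2^{#} ≤ 2^{ω(g)} ≤ g`
  have hextra : ∏ p ∈ N.primeFactors \ M.primeFactors, (1 + (p : ℚ)⁻¹) ≤ g := by
    calc ∏ p ∈ N.primeFactors \ M.primeFactors, (1 + (p : ℚ)⁻¹)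
        ≤ ∏ p ∈ N.primeFactors \ M.primeFactors, (2 : ℚ) := by
          refine Finset.prod_le_prod (fun p _ ↦ by positivity) fun p hp ↦ ?_
          have hp2 : (2 : ℚ) ≤ p := by
            exact_mod_cast (Nat.prime_of_mem_primeFactors (Finset.mem_sdiff.mp hp).1).two_le
          have : (p : ℚ)⁻¹ ≤ 1 := inv_le_one_of_one_le₀ (by linarith)
          linarith
      _ = 2 ^ (N.primeFactors \ M.primeFactors).card := Finset.prod_const 2
      _ ≤ 2 ^ g.primeFactors.card := pow_le_pow_right₀ (by norm_num) (Finset.card_le_card hdiff)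
      _ = ((2 ^ g.primeFactors.card : ℕ) : ℚ) := by push_cast; rfl
      _ ≤ g := by
          have h1 : 2 ^ g.primeFactors.card ≤ ∏ p ∈ g.primeFactors, p := by
            rw [← Finset.prod_const]
            exact Finset.prod_le_prod (fun _ _ ↦ Nat.zero_le _)
              fun p hp ↦ (Nat.prime_of_mem_primeFactors hp).two_le
          have h2 : ∏ p ∈ g.primeFactors, p ≤ g :=
            Nat.le_of_dvd (Nat.pos_of_ne_zero hg0) (Nat.prod_primeFactors_dvd g)
          exact_mod_cast h1.trans h2
  have hPM : 0 ≤ ∏ p ∈ M.primeFactors, (1 + (p : ℚ)⁻¹) :=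
    Finset.prod_nonneg fun p _ ↦ by positivity
  unfold dedekindPsi
  rw [hsplit]
  have hNq : (N : ℚ) = g * M := by rw [hNgM]; push_cast; ring
  rw [hNq]
  have hg' : (0 : ℚ) ≤ g := by positivity
  have hM' : (0 : ℚ) ≤ M := by positivity
  calc (g : ℚ) * M * ((∏ p ∈ N.primeFactors \ M.primeFactors, (1 + (p : ℚ)⁻¹)) *
        ∏ p ∈ M.primeFactors, (1 + (p : ℚ)⁻¹))
      = (∏ p ∈ N.primeFactors \ M.primeFactors, (1 + (p : ℚ)⁻¹)) *
          (g * (M * ∏ p ∈ M.primeFactors, (1 + (p : ℚ)⁻¹))) := by ring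
    _ ≤ (g : ℚ) * (g * (M * ∏ p ∈ M.primeFactors, (1 + (p : ℚ)⁻¹))) :=
        mul_le_mul_of_nonneg_right hextra (by positivity)
    _ = (g : ℚ) ^ 2 * (M * ∏ p ∈ M.primeFactors, (1 + (p : ℚ)⁻¹)) := by ring

/-! ### The four terms of the trace formula in weight `2`, trivial character -/

section Terms

variable (N : ℕ)

/-- **Identity term** `A₁(p^m) = [m even] · ψ(N)/12` for `p ∤ N` prime, weight `2`, trivial
character (Murty–Sinha (4) and (9): `A₁(n) = n^{k/2-1} (k-1)/12 ψ(N)` for `n` a square coprime to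
the level, `0` otherwise). [cite: MurtySinha2009, Thm. 10 (4) p. 692 and (9) p. 697] -/
theorem identityTerm_one_two_prime_pow (p : ℕ) (hp : p.Prime) (hpN : ¬ p ∣ N) (m : ℕ) :
    identityTerm N 1 2 (p ^ m) = if Even m then ((dedekindPsi N : ℚ) : ℂ) / 12 else 0 := by
  unfold identityTerm
  by_cases hm : Even m
  · obtain ⟨e, rfl⟩ := hm
    have hsq : IsSquare (p ^ (e + e)) := ⟨p ^ e, by rw [pow_add]⟩
    have hsqrt : Nat.sqrt (p ^ (e + e)) = p ^ e := by rw [pow_add, Nat.sqrt_eq]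
    have hunit : IsUnit ((p ^ e : ℕ) : ZMod N) :=
      (ZMod.isUnit_iff_coprime _ _).2 (Nat.Coprime.pow_left e (hp.coprime_iff_not_dvd.2 hpN))
    rw [if_pos hsq, if_pos ⟨e, rfl⟩, hsqrt, MulChar.one_apply hunit]
    norm_num
    ring
  · have hnsq : ¬ IsSquare (p ^ m) := by
      rintro ⟨s, hs⟩
      apply hm
      have hs0 : s ≠ 0 := by
        rintro rfl
        exact pow_ne_zero m hp.ne_zero (by simpa using hs)
      have h := congrArg (fun x : ℕ ↦ x.factorization p) hs
      simp only [Nat.factorization_pow, Finsupp.smul_apply, hp.factorization_self, smul_eq_mul,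
        mul_one, Nat.factorization_mul hs0 hs0, Finsupp.add_apply] at h
      exact ⟨_, h⟩
    rw [if_neg hnsq, if_neg hm]

/-- **Parabolic term:** `|A₄(n)| ≤ σ(n) ≤ n²` (Murty–Sinha (7): `A₄(n) = Σ_{t ∣ n} t` in weight `2`,
so `B₄(m) - B₄(m-2) ≤ 2p^{m/2}`). [cite: MurtySinha2009, Thm. 10 (7) p. 693] -/
theorem norm_parabolicTerm_le (χ : DirichletCharacter ℂ N) (k : ℤ) (n : ℕ) :
    ‖parabolicTerm N χ k n‖ ≤ (n : ℝ) ^ 2 := by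
  unfold parabolicTerm
  split_ifs with h
  · calc ‖∑ t ∈ n.divisors.filter (fun t ↦ Nat.Coprime N (n / t)), (t : ℂ)‖
        ≤ ∑ t ∈ n.divisors.filter (fun t ↦ Nat.Coprime N (n / t)), ‖(t : ℂ)‖ := norm_sum_le _ _
      _ ≤ ∑ t ∈ n.divisors, ‖(t : ℂ)‖ :=
          Finset.sum_le_sum_of_subset_of_nonneg (Finset.filter_subset _ _)
            (fun _ _ _ ↦ norm_nonneg _)
      _ ≤ ∑ t ∈ n.divisors, (n : ℝ) := Finset.sum_le_sum fun t ht ↦ by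
          rw [Complex.norm_natCast]
          exact_mod_cast Nat.divisor_le ht
      _ = n.divisors.card * n := by rw [Finset.sum_const, nsmul_eq_mul]
      _ ≤ n * n := by
          gcongr
          exact_mod_cast Nat.card_divisors_le_self n
      _ = (n : ℝ) ^ 2 := (sq _).symm
  · rw [norm_zero]
    positivity

/-- `|χ(y)| ≤ 1` for the value `crtCharValue` entering `A₃`. [folklore] -/
theorem norm_crtCharValue_le (χ : DirichletCharacter ℂ N) (c e a b : ℕ) :
    ‖crtCharValue N χ c e a b‖ ≤ 1 := by
  unfold crtCharValue
  split_ifs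
  · exact DirichletCharacter.norm_le_one _ _
  · rw [norm_zero]
    exact zero_le_one

/-- **Hyperbolic term:** `|A₃(n)| ≤ n² · B(N)`, `B(N) = Σ_{c ∣ N} gcd(c, N/c)`, in weight `2` with
trivial character (Murty–Sinha (6) and p. 696: `|B₃(m) - B₃(m-2)| ≤ 2 f(N)`,
`f(N) = Σ_{c ∣ N} φ(gcd(c, N/c)) ≤ √N d(N)`; here `φ(g) ≤ g`, `Σ_{d ∣ n} d ≤ n²`, `|χ(y)| ≤ 1`).
[cite: MurtySinha2009, Thm. 10 (6) p. 692 and §8 p. 696] -/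
theorem norm_hyperbolicTerm_one_two_le (n : ℕ) :
    ‖hyperbolicTerm N 1 2 n‖ ≤ (n : ℝ) ^ 2 * ∑ c ∈ N.divisors, (Nat.gcd c (N / c) : ℝ) := by
  set B := ∑ c ∈ N.divisors, (Nat.gcd c (N / c) : ℝ) with hB_def
  have hB : 0 ≤ B := Finset.sum_nonneg fun _ _ ↦ by positivity
  unfold hyperbolicTerm
  rw [norm_neg]
  have h21 : ((2 : ℤ) - 1) = 1 := by norm_num
  simp only [h21, zpow_one]
  -- the inner sums over `c ∣ N` are bounded by `B`
  have hinner : ∀ d : ℕ, ‖∑ c ∈ N.divisors.filter (fun c ↦ Nat.gcd c (N / c) ∣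
        N / (1 : DirichletCharacter ℂ N).conductor ∧
          (Nat.gcd c (N / c) : ℤ) ∣ ((n / d : ℕ) : ℤ) - d),
      (Nat.totient (Nat.gcd c (N / c)) : ℂ) * crtCharValue N 1 c (N / c) d (n / d)‖ ≤ B := by
    intro d
    refine (norm_sum_le _ _).trans ?_
    refine le_trans (Finset.sum_le_sum_of_subset_of_nonneg (Finset.filter_subset _ _)
      (fun _ _ _ ↦ norm_nonneg _)) ?_
    refine Finset.sum_le_sum fun c _ ↦ ?_
    rw [norm_mul, Complex.norm_natCast]
    calc (Nat.totient (Nat.gcd c (N / c)) : ℝ) * ‖crtCharValue N 1 c (N / c) d (n / d)‖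
        ≤ (Nat.totient (Nat.gcd c (N / c)) : ℝ) * 1 :=
          mul_le_mul_of_nonneg_left (norm_crtCharValue_le N 1 _ _ _ _) (by positivity)
      _ ≤ (Nat.gcd c (N / c) : ℝ) := by
          rw [mul_one]
          exact_mod_cast Nat.totient_le _
  calc ‖∑ d ∈ n.divisors.filter (fun d ↦ d * d ≤ n),
          (if d * d = n then (1 / 2 : ℂ) else 1) * (d : ℂ) * _‖
      ≤ ∑ d ∈ n.divisors.filter (fun d ↦ d * d ≤ n),
          ‖(if d * d = n then (1 / 2 : ℂ) else 1) * (d : ℂ) * _‖ := norm_sum_le _ _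
    _ ≤ ∑ d ∈ n.divisors.filter (fun d ↦ d * d ≤ n), (d : ℝ) * B := by
        refine Finset.sum_le_sum fun d _ ↦ ?_
        rw [norm_mul, norm_mul, Complex.norm_natCast]
        have hw : ‖(if d * d = n then (1 / 2 : ℂ) else 1)‖ ≤ 1 := by
          split_ifs <;> norm_num
        calc ‖(if d * d = n then (1 / 2 : ℂ) else 1)‖ * (d : ℝ) * _ ≤ 1 * (d : ℝ) * B := by
              refine mul_le_mul (mul_le_mul_of_nonneg_right hw (by positivity)) (hinner d)
                (norm_nonneg _) (by positivity)
          _ = (d : ℝ) * B := by rw [one_mul]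
    _ ≤ ∑ d ∈ n.divisors, (d : ℝ) * B :=
        Finset.sum_le_sum_of_subset_of_nonneg (Finset.filter_subset _ _)
          (fun _ _ _ ↦ by positivity)
    _ ≤ ∑ d ∈ n.divisors, (n : ℝ) * B :=
        Finset.sum_le_sum fun d hd ↦
          mul_le_mul_of_nonneg_right (by exact_mod_cast Nat.divisor_le hd) hB
    _ = n.divisors.card * ((n : ℝ) * B) := by rw [Finset.sum_const, nsmul_eq_mul]
    _ ≤ (n : ℝ) * ((n : ℝ) * B) := by
        refine mul_le_mul_of_nonneg_right ?_ (by positivity)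
        exact_mod_cast Nat.card_divisors_le_self n
    _ = (n : ℝ) ^ 2 * B := by ring

/-- **Local densities:** `|μ(t, f, n)| ≤ f² · B(N)` for `f ≥ 1` and the trivial character
(Murty–Sinha p. 699: `μ(t, f, n) ≤ ψ(N_f) M(t, n, N N_f)`; here `ψ(N)/ψ(N/N_f) ≤ N_f² ≤ f²` by
`dedekindPsi_le_sq_mul_dedekindPsi_div` and `M(t, n, N N_f) ≤ M(t, n, N) ≤ B(N)` by
`card_filter_dvd_quadratic_le`). [cite: MurtySinha2009, §9 p. 699 (bound for μ(t, f, n))] -/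
theorem norm_localDensity_one_le [NeZero N] (t : ℤ) (f n : ℕ) (hf : f ≠ 0) :
    ‖localDensity N 1 t f n‖ ≤ (f : ℝ) ^ 2 * ∑ c ∈ N.divisors, (Nat.gcd c (N / c) : ℝ) := by
  have hN : N ≠ 0 := NeZero.ne N
  set B := ∑ c ∈ N.divisors, (Nat.gcd c (N / c) : ℝ) with hB_def
  have hB : 0 ≤ B := Finset.sum_nonneg fun _ _ ↦ by positivity
  set g := Nat.gcd N f with hg_def
  have hg : g ∣ N := Nat.gcd_dvd_left N f
  have hgf : g ≤ f := Nat.le_of_dvd (Nat.pos_of_ne_zero hf) (Nat.gcd_dvd_right N f)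
  have hNg0 : N / g ≠ 0 := by
    intro h
    rcases Nat.div_eq_zero_iff.mp h with h0 | hlt
    · exact hN (Nat.eq_zero_of_gcd_eq_zero_left h0)
    · exact absurd (Nat.le_of_dvd (Nat.pos_of_ne_zero hN) hg) (not_le.mpr hlt)
  unfold localDensity
  rw [norm_mul]
  -- the level factor
  have h1 : ‖(((dedekindPsi N / dedekindPsi (N / g) : ℚ)) : ℂ)‖ ≤ (g : ℝ) ^ 2 := by
    rw [Complex.norm_ratCast]
    have hpos : 0 < dedekindPsi (N / g) :=
      lt_of_lt_of_le (by exact_mod_cast Nat.pos_of_ne_zero hNg0) (le_dedekindPsi _)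
    have hq : dedekindPsi N / dedekindPsi (N / g) ≤ (g : ℚ) ^ 2 := by
      rw [div_le_iff₀ hpos]
      exact dedekindPsi_le_sq_mul_dedekindPsi_div hN hg
    have hq0 : 0 ≤ dedekindPsi N / dedekindPsi (N / g) := div_nonneg (dedekindPsi_nonneg _) hpos.le
    rw [abs_of_nonneg (by exact_mod_cast hq0)]
    exact_mod_cast hq
  -- the root count
  have hNg : (N : ℤ) ∣ ((N * g : ℕ) : ℤ) := ⟨(g : ℤ), by push_cast; ring⟩
  have h2 : ‖∑ x ∈ Finset.range N, (if ((N * g : ℕ) : ℤ) ∣ (x : ℤ) ^ 2 - t * x + n then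
      (1 : DirichletCharacter ℂ N) (x : ZMod N) else 0)‖ ≤ B := by
    calc _ ≤ ∑ x ∈ Finset.range N, ‖(if ((N * g : ℕ) : ℤ) ∣ (x : ℤ) ^ 2 - t * x + n then
          (1 : DirichletCharacter ℂ N) (x : ZMod N) else 0)‖ := norm_sum_le _ _
      _ ≤ ∑ x ∈ Finset.range N, (if (N : ℤ) ∣ (x : ℤ) ^ 2 - t * x + n then (1 : ℝ) else 0) := by
          refine Finset.sum_le_sum fun x _ ↦ ?_
          split_ifs with h1 h2
          · exact DirichletCharacter.norm_le_one _ _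
          · exact absurd (hNg.trans h1) h2
          · rw [norm_zero]
            exact zero_le_one
          · rw [norm_zero]
      _ = (((Finset.range N).filter fun x : ℕ ↦ (N : ℤ) ∣ (x : ℤ) ^ 2 - t * x + n).card : ℝ) := by
          rw [Finset.sum_boole]
      _ ≤ ((∑ d ∈ N.divisors, Nat.gcd d (N / d) : ℕ) : ℝ) := by
          exact_mod_cast card_filter_dvd_quadratic_le N hN t n
      _ = B := by rw [hB_def, Nat.cast_sum]
  calc _ ≤ (g : ℝ) ^ 2 * B := mul_le_mul h1 h2 (norm_nonneg _) (by positivity)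
    _ ≤ (f : ℝ) ^ 2 * B := by
        refine mul_le_mul_of_nonneg_right ?_ hB
        have : (g : ℝ) ≤ f := by exact_mod_cast hgf
        gcongr

/-- **Elliptic term:** `|A₂(n)| ≤ 7360 n⁶ · B(N)` for `n ≥ 1`, weight `2`, trivial character
(Murty–Sinha (5), (8), (12): `|A₂(n)| ≤ 4 n^{k/2} σ(n) 4^{ν(N)}`-type bounds via Hurwitz and
Huxley; here crudely: at most `4n+1` values of `t`, at most `4n` conductors `f`,
`h_w ≤ 46 n²` (`classNumber_le`), `|μ(t,f,n)| ≤ 16 n² B(N)` (`norm_localDensity_one_le`), and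
the weight-`2` archimedean factor is `1`). [cite: MurtySinha2009, Thm. 10 (5) p. 692, (8) p. 695, (12) p. 699] -/
theorem norm_ellipticTerm_one_two_le [NeZero N] (n : ℕ) (hn : 1 ≤ n) :
    ‖ellipticTerm N 1 2 n‖ ≤ 7360 * (n : ℝ) ^ 6 * ∑ c ∈ N.divisors, (Nat.gcd c (N / c) : ℝ) := by
  set B := ∑ c ∈ N.divisors, (Nat.gcd c (N / c) : ℝ) with hB_def
  have hB : 0 ≤ B := Finset.sum_nonneg fun _ _ ↦ by positivity
  have hn' : (1 : ℝ) ≤ n := by exact_mod_cast hn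
  -- bound for one conductor `f`
  have hf_bound : ∀ t : ℤ, t ^ 2 < 4 * (n : ℤ) → ∀ f ∈ ellipticConductors t n,
      ‖(weightedClassNumber ((t ^ 2 - 4 * n) / (f : ℤ) ^ 2) : ℂ) * localDensity N 1 t f n‖ ≤
        736 * (n : ℝ) ^ 4 * B := by
    intro t ht f hf
    rw [ellipticConductors, Finset.mem_filter] at hf
    obtain ⟨hfdiv, hf2, -⟩ := hf
    have hf0 : f ≠ 0 := Nat.ne_of_gt (Nat.pos_of_mem_divisors hfdiv)
    have hfle : f ≤ (4 * n - t ^ 2).toNat := Nat.divisor_le hfdiv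
    have ht2 : 0 ≤ t ^ 2 := sq_nonneg t
    have hfle' : (f : ℤ) ≤ 4 * n := by omega
    set Δ : ℤ := (t ^ 2 - 4 * n) / (f : ℤ) ^ 2 with hΔ
    have hΔabs : Δ.natAbs ≤ 4 * n := by
      have hmul : Δ * (f : ℤ) ^ 2 = t ^ 2 - 4 * n := Int.ediv_mul_cancel hf2
      have h1 : Δ.natAbs ≤ Δ.natAbs * ((f : ℤ) ^ 2).natAbs :=
        Nat.le_mul_of_pos_right _ (Int.natAbs_pos.mpr (pow_ne_zero 2 (by exact_mod_cast hf0)))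
      rw [← Int.natAbs_mul, hmul] at h1
      omega
    -- class number factor
    have hw : ‖(weightedClassNumber Δ : ℂ)‖ ≤ 46 * (n : ℝ) ^ 2 := by
      rw [Complex.norm_ratCast, abs_of_nonneg (by exact_mod_cast weightedClassNumber_nonneg Δ)]
      have h1 : (weightedClassNumber Δ : ℝ) ≤ (BinQF.classNumber Δ : ℝ) + 1 := by
        exact_mod_cast weightedClassNumber_le Δ
      have h2 : (BinQF.classNumber Δ : ℝ) ≤ (Δ.natAbs + 1) * (2 * Δ.natAbs + 1) := by
        exact_mod_cast classNumber_le Δ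
      have h3 : (Δ.natAbs : ℝ) ≤ 4 * n := by exact_mod_cast hΔabs
      nlinarith
    -- local density factor
    have hμ : ‖localDensity N 1 t f n‖ ≤ 16 * (n : ℝ) ^ 2 * B := by
      refine (norm_localDensity_one_le N t f n hf0).trans ?_
      have : (f : ℝ) ≤ 4 * n := by exact_mod_cast hfle'
      have : (f : ℝ) ^ 2 ≤ 16 * (n : ℝ) ^ 2 := by nlinarith
      exact mul_le_mul_of_nonneg_right this hB
    rw [norm_mul]
    calc ‖(weightedClassNumber Δ : ℂ)‖ * ‖localDensity N 1 t f n‖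
        ≤ (46 * (n : ℝ) ^ 2) * (16 * (n : ℝ) ^ 2 * B) :=
          mul_le_mul hw hμ (norm_nonneg _) (by positivity)
      _ = 736 * (n : ℝ) ^ 4 * B := by ring
  -- bound for one trace `t`
  have ht_bound : ∀ t ∈ (Finset.Icc (-(2 * n : ℤ)) (2 * n)).filter (fun t : ℤ ↦ t ^ 2 < 4 * (n : ℤ)),
      ‖archFactor 2 t n * ∑ f ∈ ellipticConductors t n,
        (weightedClassNumber ((t ^ 2 - 4 * n) / (f : ℤ) ^ 2) : ℂ) * localDensity N 1 t f n‖ ≤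
        4 * n * (736 * (n : ℝ) ^ 4 * B) := by
    intro t ht
    have ht' : t ^ 2 < 4 * (n : ℤ) := (Finset.mem_filter.mp ht).2
    rw [norm_mul, archFactor_two ht', norm_one, one_mul]
    have hcard : ((ellipticConductors t n).card : ℝ) ≤ 4 * n := by
      have h1 : (ellipticConductors t n).card ≤ (4 * n - t ^ 2).toNat := by
        unfold ellipticConductors
        exact (Finset.card_filter_le _ _).trans (Nat.card_divisors_le_self _)
      have ht2 : 0 ≤ t ^ 2 := sq_nonneg t
      have h2 : (4 * n - t ^ 2).toNat ≤ 4 * n := by omega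
      exact_mod_cast h1.trans h2
    calc _ ≤ ∑ f ∈ ellipticConductors t n,
          ‖(weightedClassNumber ((t ^ 2 - 4 * n) / (f : ℤ) ^ 2) : ℂ) * localDensity N 1 t f n‖ :=
          norm_sum_le _ _
      _ ≤ ∑ f ∈ ellipticConductors t n, 736 * (n : ℝ) ^ 4 * B :=
          Finset.sum_le_sum fun f hf ↦ hf_bound t ht' f hf
      _ = (ellipticConductors t n).card * (736 * (n : ℝ) ^ 4 * B) := by
          rw [Finset.sum_const, nsmul_eq_mul]
      _ ≤ 4 * n * (736 * (n : ℝ) ^ 4 * B) := mul_le_mul_of_nonneg_right hcard (by positivity)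
  have hT : (((Finset.Icc (-(2 * n : ℤ)) (2 * n)).filter (fun t : ℤ ↦ t ^ 2 < 4 * (n : ℤ))).card : ℝ)
      ≤ 5 * n := by
    have h1 : ((Finset.Icc (-(2 * n : ℤ)) (2 * n)).filter (fun t : ℤ ↦ t ^ 2 < 4 * (n : ℤ))).card
        ≤ 4 * n + 1 := by
      refine (Finset.card_filter_le _ _).trans ?_
      rw [Int.card_Icc]
      omega
    have h2 : ((4 * n + 1 : ℕ) : ℝ) ≤ 5 * n := by push_cast; linarith
    exact le_trans (by exact_mod_cast h1) h2
  unfold ellipticTerm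
  rw [norm_mul, norm_neg]
  have hhalf : ‖(1 / 2 : ℂ)‖ = 1 / 2 := by norm_num
  rw [hhalf]
  calc 1 / 2 * ‖∑ t ∈ _, archFactor 2 t n * ∑ f ∈ ellipticConductors t n,
          (weightedClassNumber ((t ^ 2 - 4 * n) / (f : ℤ) ^ 2) : ℂ) * localDensity N 1 t f n‖
      ≤ 1 / 2 * ∑ t ∈ (Finset.Icc (-(2 * n : ℤ)) (2 * n)).filter (fun t : ℤ ↦ t ^ 2 < 4 * (n : ℤ)),
          ‖archFactor 2 t n * ∑ f ∈ ellipticConductors t n,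
            (weightedClassNumber ((t ^ 2 - 4 * n) / (f : ℤ) ^ 2) : ℂ) * localDensity N 1 t f n‖ :=
        mul_le_mul_of_nonneg_left (norm_sum_le _ _) (by norm_num)
    _ ≤ 1 / 2 * ∑ t ∈ (Finset.Icc (-(2 * n : ℤ)) (2 * n)).filter (fun t : ℤ ↦ t ^ 2 < 4 * (n : ℤ)),
          4 * n * (736 * (n : ℝ) ^ 4 * B) :=
        mul_le_mul_of_nonneg_left (Finset.sum_le_sum ht_bound) (by norm_num)
    _ = 1 / 2 * ((((Finset.Icc (-(2 * n : ℤ)) (2 * n)).filter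
          (fun t : ℤ ↦ t ^ 2 < 4 * (n : ℤ))).card : ℝ) * (4 * n * (736 * (n : ℝ) ^ 4 * B))) := by
        rw [Finset.sum_const, nsmul_eq_mul]
    _ ≤ 1 / 2 * (5 * n * (4 * n * (736 * (n : ℝ) ^ 4 * B))) := by
        refine mul_le_mul_of_nonneg_left ?_ (by norm_num)
        exact mul_le_mul_of_nonneg_right hT (by positivity)
    _ = 7360 * (n : ℝ) ^ 6 * B := by ring

end Terms

end MurtySinha

end Literature.NumberTheory.EllipticCurves.ModularForms
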